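import Mathlib
import HarnessLib
import HarnessLib.Audit
import Summits.NavierStokesRegularity.Statement
import Literature.Analysis.FluidPDE.ClassicalSolution
import Literature.Analysis.FluidPDE.LerayHopf
import Literature.Analysis.FluidPDE.SuitableWeak
import Literature.Analysis.FluidPDE.VectorCalculus
import Literature.Analysis.FluidPDE.Vorticity
import Literature.Analysis.FluidPDE.NSWave0
import Literature.Analysis.FluidPDE.SelfSimilar
import Summits.NavierStokesRegularity.NavierStokesRegularity.Theorems.TypeICertificateLadderNoBlowupToClay
import HarnessLib.Audit.Status.Attr

/-!
Route: DirectionDissipationQuantum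

DORMANT since 2026-08-29T19:39:15Z (census g0: costume|duplicate of route-NavierStokesRegularity-DirectionEnergy; reader census-reader-50-g0) — unstaffed, not closed; items shared with open routes are served there. `ledger route dormant <id> --off` reactivates.

# Route DirectionDissipationQuantum — NavierStokesRegularity (Clay A), positive side (geometric
ε-regularity)
Card realised: NavierStokesRegularity/NavierStokesRegularity/direction-dissipation-quantum (spine);
the sibling card
direction-energy-epsilon-regularity posits the same pivot W = G and is covered by crux #2 (its
harmonic-map-heat-flow
reading and '2D + small' stability are alternative proof ideas for #2, not separate statements).

## Thesis X = A ∧ N ("it suffices to show"), ν normalised to 1 (CKN convention; ν-scaling is support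
item UnitViscosityReduction)
Notation. ω = curl u, ξ = ω/|ω| (in-tree vorticityDirection, junk 0 at ω = 0), DIRECTION DISSIPATION
DENSITY d = |ω| |∇ξ|²
(|∇ξ|² = frobeniusNormSq of the classical Fréchet derivative; d = 0 where ω = 0), and for a top
point z = (T,x) and r > 0
  G(r, z; u) := r⁻¹ ∫∫_{Q_r(z)} d,   Q_r(z) = (T − r², T) × B_r(x) the BACKWARD parabolic cylinder
(in-tree parabolicCylinder).
G is dimensionless (same scaling as CKN's E(r) = r⁻¹∫∫|∇u|²) and a-priori budgeted: ∫₀ᵀ∫ d ≤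
½ν⁻²‖u₀‖²₂ (Constantin1990;
book:cannone2006 p.47), so, exactly like E, it can stay ≥ ε only on a P¹-null set of top points.
(A) GEOMETRIC ε-REGULARITY (crux #2, strong form): there is an absolute ε > 0 such that for every
classical solution of NS
    (ν = 1, f = 0) on ℝ³×[0,T) that is Leray–Hopf from a rapidly decaying datum and every x: if
G(r,(T,x);u) ≤ ε for all
    small r, then u is bounded on some Q_r(T,x).  "A singularity carries a quantum of direction
dissipation."
(N) NON-CONCENTRATION (crux #4, a priori): for the same class, at every x, G(r,(T,x);u) → 0 as r →
0.
Lean (elaborates; planner Sketch.lean rc 0): Target :=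
  (∃ ε > 0, ∀ T > 0, ∀ u p, IsClassicalNSSolutionOn (Ico 0 T) 1 0 u p → IsLerayHopfOn T 1 0 (u 0) u
→ HasRapidSpatialDecay (u 0) →
     ∀ x, (∃ r₀ > 0, ∀ r ∈ Ioo 0 r₀, G r (T,x) ≤ ofReal ε) → ∃ r > 0, ∃ M, ∀ t ∈ Ioo (T − r²) T, ∀ y
∈ ball x r, ‖u t y‖ ≤ M)
  ∧ (∀ T > 0, ∀ u p, [same class] → ∀ x, ∀ η > 0, ∃ r₀ > 0, ∀ r ∈ Ioo 0 r₀, G r (T,x) ≤ ofReal η)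
with G r (T,x) := (ENNReal.ofReal r)⁻¹ * ∫⁻ q in parabolicCylinder r (T,x), ofReal (‖curl (u q.1)
q.2‖ * frobeniusNormSq (fderiv ℝ (vorticityDirection (curl (u q.1))) q.2)).

## Assembly X → NavierStokesRegularity (PURE LOGIC, proved sorry-free in Sketch.lean, ~12 lines)
A → N → BoundedNearTopExtends (local boundedness at every top point ⇒ HasSmoothExtensionPast;
far-field bound + Leray's rate,
both PROVED in tree) → UnitViscosityReduction (NoBlowup at ν = 1 ⇒ NoBlowup) → NoBlowupToClay (=
stmt-NavierStokesRegularity-0055,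
shared with TypeILiouville/GaldiLiouvilleGate) → NavierStokesRegularity.

## Two-layer plan (D-0019)
Layer 1 (ranked cruxes): #2 A GeometricEpsilonRegularity; #3 B TypeIDirectionCriterion (A's
conclusion under the Type-I rate with
ε replaced by 0 — the integral upgrade of Giga–Miura/Barker–Prange continuous alignment; a rung of
A, A → B pure logic); #4 N.
Support: UnidirectionalAncientLiouville (engine of B: bounded ancient mild + unidirectional
vorticity ⇒ slice-wise constant, from
the PROVED in-tree KNSS planar Liouville), BoundedNearTopExtends, UnitViscosityReduction,
NoBlowupToClay.
Layer 2 (later, glued splits): A ↦ (B) + (Type-II exclusion at G-small points); B ↦ (top-centred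
Type-I compactness with
d ≡ 0 in the limit) + (UnidirectionalAncientLiouville) + (persistence of the vertex singularity,
in-tree A–B/Rusin–Šverák tools).

Rationale: WHY THIS LINE. CKN's ε-regularity (in-tree ckn_epsilon_regularity_holds, PROVED) uses the
dissipation density |∇u|²; the only
supercritical mechanism, vortex stretching, is invisible to it, and NSI fakes (Scheffer/Ozański)
show the energy class cannot do
better than P¹(S) = 0. The vorticity-magnitude balance (∂_t + u·∇ − Δ)|ω| + |ω||∇ξ|² = (ξ·Sξ)|ω|
(Constantin1990) has its own
dissipation, the DIRECTION DISSIPATION d = |ω||∇ξ|², which (i) is a-priori space-time integrable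
from Clay data with EXACTLY the
CKN scaling (∫∫ d ≤ ½ν⁻²‖u₀‖², book:cannone2006 p.47), (ii) vanishes iff vortex lines are locally
straight (then div ω = 0 makes the
flow 2.5D, regular), and (iii) controls stretching through the localised Constantin identity
∫(ξ·Sξ)|ω|φ = −∫u·(ω·∇ξ)φ − ∫(u·ξ)(ω·∇φ)
≤ (∫|u|²|ω|φ)^{1/2}(∫dφ)^{1/2} + cut-off terms. GKT2007 (arXiv:math/0607114 p.4) name exactly this
hope: a-priori vorticity
estimates à la Constantin use the vorticity EQUATION, which Scheffer's examples do not satisfy. The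
route runs ε-regularity with
G(r) = r⁻¹∫∫_{Q_r} d as the small quantity (crux A), makes its Type-I case a near-term theorem (crux
B: blow-up centred at the top
point as in BarkerPrange2020Alignment Thm 3, limit with d ≡ 0, killed by a unidirectional Liouville
lemma resting on the PROVED
in-tree KNSS planar theorem), and isolates the a-priori bet (crux N). Imported areas: geometric
measure theory of ε-regularity
(CKN/Lin/GKT), Liouville rigidity for ancient solutions (KNSS2009, GigaMiura2011,
GigaHsuMaekawa2014), harmonic-map-type
direction energies (Constantin1990; the sibling card's HMHF reading). No probabilistic/spectral
reformulation: none touches ∇ξ.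
RANKED CRUXES. #2 A GeometricEpsilonRegularity (strong form, G alone; most informative: either a new
Literature-grade
ε-regularity theorem or a precise statement of how a singularity must kink vortex lines) — why it
might fail: the L¹-vorticity
level is the excluded Calderón–Zygmund corner (p,q) = (1,∞) of GKT2007 Thm 1.1(iii); a Type-II,
nearly-2.5D concentration with
tiny twist (G → 0 while E → ∞) is not excluded by any perturbative '2D + small' theorem. #3 B
TypeIDirectionCriterion (Type-I
rate + G → 0 at (T,x) ⇒ bounded near (T,x); A → B is pure logic, so B is the first rung) — why it
might fail: the limit must
inherit d ≡ 0 (C¹_loc convergence of ω near zeros of ω̄; analyticity/unique continuation to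
globalise 'ξ̄ locally constant');
persistence of the vertex singularity needs A–B Type-I bounds from the sup-norm rate. #4 N
DirectionDissipationNonConcentration
(a priori, pointwise at every top point) — why it might fail: NoBlowup-hard given A; Constantin's
budget is energy-class
(EnergySupercriticality) and gives only P¹-null concentration; no mechanism claimed beyond the
flux/degree constraints on kinked
tubes recorded on the card. Support: UnidirectionalAncientLiouville, BoundedNearTopExtends,
UnitViscosityReduction,
NoBlowupToClay (stmt-0055).
KILL CRITERIA. A refuted (a Leray–Hopf classical solution singular at (T,x) with G → 0 there) closes
the route unless B and N
survive — then pivot (tenure) to the Type-I assembly B ∧ N ∧ NoTypeII (stmt-0056, shared with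
TypeILiouville). N refuted at a
REGULAR time (pathology of d at degenerate vorticity zeros) ⇒ restate G with Constantin's
regularised density, not a kill.
N refuted at a singular time = ¬Clay(A)-level event. B refuted ⇒ the Liouville engine or the
compactness is wrong: close.
Numerics (card 'fastest refutation'): G and E across scales at the vorticity maximum of Hou-type
data (Hou2022PotentiallySingularNS)
— G → 0 with E ≥ ε₀ over decades of r kills A in practice.
NOT DECOMPOSED (deliberately). The CKN/Lin-type iteration for A (which third scaled quantity — C(r),
W(r) = sup_t r⁻¹∫_{B_r}|ω|, or
|ω|log(2+|ω|) — closes it); the localised Constantin identity and the |ω|-balance for smooth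
solutions (Lean-sized lemmas, to be
attached with --supports); the tangent-direction-map/flux layer of the card (item 3, speculative);
the hybrid product form E·G
(recorded: in ℝ≥0∞ ⊤·0 = 0 makes the naive product statement refutable by parasitic examples — file
only with a Type-I guard);
Constantin's bound as a named Literature fact (cite item filed); the notion
scaledDirectionDissipation (definition request filed).
NUMBERS. Budget ∫∫ d ≤ ½ν⁻²‖u₀‖²₂ (Cannone LNM 1871 p.47); GKT vorticity range 2 ≤ 3/p + 2/q ≤ 3,
(p,q) ≠ (1,∞) (arXiv:math/0607114
pp.2–3); in-tree PROVED facts used by the frame: ckn_epsilon_regularity_holds,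
ckn_partial_regularity_holds,
KNSS2009_liouville_planar_holds, KNSS2009_blowup_generates_ancient_holds,
KNSS2009_mild_regularity_holds, leray_blowup_rate_top_holds,
leray_solution_farField_bound_slab_holds, rusin_sverak_stability_of_singularities_holds,
serrin_weak_strong_uniqueness_holds.
Items: 9 (3 cruxes, 4 support, target, assembly). Prior-programme inspiration notes: not read
(plancard mode).

Novelty: NOVELTY (searched 2026-08-15 before claiming: `lit search --hybrid` "vorticity direction epsilon
regularity suitable weak solutions
Constantin |omega||nabla xi|^2" (15 held books; Cannone LNM1871 pp.46-48 read: the budget, no local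
statement); crossref
"Chae Wolf new condition vorticity partial regularity" (10 rows: doi:10.1007/s00205-024-02068-7,
doi:10.1007/978-3-642-04068-9_34,
doi:10.1080/03605300601088823, doi:10.1007/s00021-002-8544-9, Neustupa 2013/2014); zbMATH + S2 for
ChaeWolf2024 (title only, no
abstract; OpenAlex 429; acq-01619 open); S2 "vorticity direction type I blow-up integral condition
alignment Liouville" (GigaGuHsu
2019 doi:10.1016/j.na.2019.111579, BarkerPrange2020Alignment arXiv:1906.08225 READ Thm 1/Thm 3/p.4,
GigaMiura2011 paywalled
acq-01588); crossref "vorticity direction geometric depletion localization Grujic" (Grujic IUMJ 2001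
doi:10.1512/iumj.2001.50.1900,
RuzmaikinaGrujic CMP 2004, Zhou 2005, survey doi:10.1007/978-3-319-10151-4_18-1); `lit read
arXiv:math/0607114` (GKT2007 Thm 1.1
pp.2-4 READ); `lit read arXiv:1310.6471` (GHM2014 Thm 1.2, p.16 READ); `lit frontier
NavierStokesRegularity --since 2022` (30 rows,
none on direction criteria); `lit galaxy search --star all` attempted twice (galaxyd rc 75,
recorded); the card's and the
sibling card's novelty audits (refuters 7-0 and 1-g2-0, both new-combination).)
Nearest prior art. (1) ε-regularity families: CaffarelliKohnNirenberg1982 Prop 2 / Lin1998 Thm 1.1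
(in-tree PROVED
ckn_epsilon_regularity_  [refs: 10.1007/s00205-024-02068-7, 10.1007/978-3-642-04068-9_34, 10.1080/03605300601088823, 10.1007/s00021-002-8544-9, 10.1016/j.na.2019.111579, 10.1512/iumj.2001.50.1900, 10.1007/978-3-319-10151-4_18-1, 1906.08225, math/0607114, 1310.6471, doi:10.1007/s00205-024-02068-7, doi:10.1007/978-3-642-04068-9_34, doi:10.1080/03605300601088823, doi:10.1007/s00021-002-8544-9, doi:10.1016/j.na.2019.111579, doi:10.1]

Barriers (technique_class: geometric-epsilon-regularity direction-dissipation liouville): BARRIERS (catalogue lean/Literature/Barriers/NavierStokesRegularity read by file name;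
technique_class: geometric-epsilon-regularity direction-dissipation liouville).
- Literature.Barriers.NavierStokesRegularity.NavierStokesInequalitySingularSolution (CKN-class
iterations valid for every NSI
  solution cannot beat dim 1; Scheffer/Ozański): EVADED IN FORM — G, the |ω|-balance, div ω = 0 and
the Constantin identity use the
  vorticity EQUATION, which NSI solutions do not satisfy (GKT2007 p.4 makes the same point about
Constantin's estimate); crux A is
  stated for genuine classical Leray–Hopf solutions below the top time, not for the NSI class.
- Literature.Barriers.NavierStokesRegularity.EnergySupercriticality: cruxes A, B are scale-invariant
ε-regularity / rigidity
  statements (legitimate use of critical quantities, no energy coercivity claimed). It BITES on crux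
N: Constantin's budget
  ∫∫|ω||∇ξ|² ≤ ½ν⁻²‖u₀‖² has energy scaling and buys only P¹-null concentration — NOT evaded; the
bet (card, flagged speculative) is
  geometric: concentration of G needs |∇ξ| ~ 1/r on the support of |ω| ~ 1/r² (a kinked tube),
constrained by div(|ω|ξ) = 0
  (no hedgehog tangent maps, zero net flux through small spheres) and the Biot–Savart cost of
bending.
- Literature.Barriers.NavierStokesRegularity.TaoAveragedBlowup: evaded in form for A, B (they rest
on ω = curl u, div ω = 0,
  the transport–stretching structure and the 2.5D reduction, none of which an averaged bilinear
operator has; Tao a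

Novelty grade: new-combination — ROUTE REVIEW (refuter 2026-08-15): well-formed, BUT a near-duplicate of route-NavierStokesRegularity-DirectionEnergy (opened 10 min later from the sibling card) — RECOMMEND CONSOLIDATION (close one as superseded): 2891 ≡ N 1922 (ν general vs ν=1; Tendsto vs ε-r₀), 2892 ≡ B 1921, 2893 ≡ 1923, 2894 ≡  (refuter refuter-rreview-route-HodgeConjecture-Co-9cfa3678-0, 2026-08-15T12:41:37Z; prior: CaffarelliKohnNirenberg1982 Prop 2 / Lin1998 Thm 1.1 (in-tree ckn_epsilon_regularity_holds), arXiv:math/0607114 (GustafsonKangTsai2007 Thm 1.1(iii), corner (1,∞) excluded), Constantin1990 (budget ∫∫|ω||∇ξ|² ≤ ½ν⁻²‖u₀‖²; book:cannone2006 p.47), doi:10.1007/s00205-024-02068-7 (ChaeWolf2024 ARMA, unread, cite-only acq-01619), arXiv:1906.08225 (BarkerPrange2020 Thm 3), arXiv:1310.6471 (GigaHsuMaekawa2)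

History (route lifecycle, newest last):
- 2026-08-25T15:17:02Z · DORMANT — reconciler: no traction for 7.8 d (last activity item-proof-filed at 2026-08-17T19:18:11Z); parked, not closed — `ledger route dormant route-NavierStokesRegular (operator:999:4037256)
- 2026-08-27T04:04:52Z · REACTIVATED — reconciler: reactivated — activity item-proof-filed at 2026-08-27T02:29:38Z after parking at 2026-08-25T15:17:02Z (operator:999:1367549)
- 2026-08-29T19:39:15Z · DORMANT — census g0: costume|duplicate of route-NavierStokesRegularity-DirectionEnergy; reader census-reader-50-g0 (operator:999:1530663)

sub-problem: NavierStokesRegularity · status: dormant · opened planner-plancard-NavierStokesRegularity-Navie-a3a92e26-0 2026-08-15T10:59:41Z · rev 2 · ledger route-NavierStokesRegularity-DirectionDissipationQuantum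
GENERATED by the gate from the ledger (D-0016/17). Provers cite these decls: `theorem foo : Summit.NavierStokesRegularity.NavierStokesRegularity.Theses.DirectionDissipationQuantum.<Decl> := …` in Summits/NavierStokesRegularity/NavierStokesRegularity/Theorems/<Name>.lean.
-/

namespace Summit.NavierStokesRegularity.NavierStokesRegularity.Theses.DirectionDissipationQuantum

open scoped BigOperators Topology Manifold Classical MeasureTheory ProbabilityTheory Matrix InnerProductSpace ComplexConjugate ContinuousMap
open Filter Set Function TopologicalSpace MeasureTheory

attribute [summit_statement] _root_.NavierStokesRegularity

open Literature.NS

/-- item stmt-NavierStokesRegularity-1918 · target · rank 0 · open · by planner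
why it might fail: A: the L¹-vorticity level is the excluded CZ corner (p,q)=(1,∞) of GKT2007 Thm 1.1(iii); a Type-II nearly-2.5D concentration with tiny twist (G→0, E→∞) would refute it. N: NoBlowup-hard given A; Constantin's budget is energy-class (P¹-null only).
sources: Constantin1990, CaffarelliKohnNirenberg1982, Lin1998, GustafsonKangTsai2007, ConstantinFefferman1993, BarkerPrange2020Alignment
[target] X = A ∧ N (card direction-dissipation-quantum): (A) GEOMETRIC ε-REGULARITY with
Constantin's direction dissipation as the small quantity — ∃ absolute ε>0: for a classical NS
solution (ν=1, f=0) on ℝ³×[0,T), Leray–Hopf from a rapidly decaying datum, and a top point (T,x):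
G(r,(T,x);u) ≤ ε for all small r ⇒ u bounded on some Q_r(T,x); (N) NON-CONCENTRATION: for the same
class G(r,(T,x);u) → 0 as r → 0 at every x. G(r,(T,x);u) = r⁻¹∫∫_{Q_r(T,x)} |ω||∇ξ|² (ω = curl u, ξ
= ω/|ω| = vorticityDirection, |∇ξ|² = frobeniusNormSq of fderiv, backward cylinder parabolicCylinder
r (T,x); density 0 where ω = 0). ν normalised to 1 (UnitViscosityReduction). Conjunction of the
bodies of GeometricEpsilonRegularity and DirectionDissipationNonConcentration (Iff.rfl in
Sketch.lean). -/
@[route_item "route-NavierStokesRegularity-DirectionDissipationQuantum"]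
def Target : Prop :=
  (∃ ε : ℝ, 0 < ε ∧ ∀ T : ℝ, 0 < T → ∀ (u : ℝ → EuclideanSpace ℝ (Fin 3) → EuclideanSpace ℝ (Fin 3)) (p : ℝ → EuclideanSpace ℝ (Fin 3) → ℝ), Literature.Analysis.FluidPDE.IsClassicalNSSolutionOn (Set.Ico 0 T) 1 0 u p → Literature.Analysis.FluidPDE.IsLerayHopfOn T 1 0 (u 0) u → Literature.Analysis.FluidPDE.HasRapidSpatialDecay (u 0) → ∀ x : EuclideanSpace ℝ (Fin 3), (∃ r₀ : ℝ, 0 < r₀ ∧ ∀ r ∈ Set.Ioo 0 r₀, (ENNReal.ofReal r)⁻¹ * (∫⁻ q in Literature.Analysis.FluidPDE.parabolicCylinder r ((T, x) : ℝ × EuclideanSpace ℝ (Fin 3)), ENNReal.ofReal (‖Literature.Analysis.FluidPDE.curl (u q.1) q.2‖ * Literature.Analysis.FluidPDE.frobeniusNormSq (fderiv ℝ (Literature.Analysis.FluidPDE.vorticityDirection (Literature.Analysis.FluidPDE.curl (u q.1))) q.2))) ≤ ENNReal.ofReal ε) → ∃ r : ℝ, 0 < r ∧ ∃ M : ℝ,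 ∀ t ∈ Set.Ioo (T - r ^ 2) T, ∀ y ∈ Metric.ball x r, ‖u t y‖ ≤ M) ∧ (∀ T : ℝ, 0 < T → ∀ (u : ℝ → EuclideanSpace ℝ (Fin 3) → EuclideanSpace ℝ (Fin 3)) (p : ℝ → EuclideanSpace ℝ (Fin 3) → ℝ), Literature.Analysis.FluidPDE.IsClassicalNSSolutionOn (Set.Ico 0 T) 1 0 u p → Literature.Analysis.FluidPDE.IsLerayHopfOn T 1 0 (u 0) u → Literature.Analysis.FluidPDE.HasRapidSpatialDecay (u 0) → ∀ x : EuclideanSpace ℝ (Fin 3), ∀ η : ℝ, 0 < η → ∃ r₀ : ℝ, 0 < r₀ ∧ ∀ r ∈ Set.Ioo 0 r₀, (ENNReal.ofReal r)⁻¹ * (∫⁻ q in Literature.Analysis.FluidPDE.parabolicCylinder r ((T, x) : ℝ × EuclideanSpace ℝ (Fin 3)), ENNReal.ofReal (‖Literature.Analysis.FluidPDE.curl (u q.1) q.2‖ * Literature.Analysis.FluidPDE.frobeniusNormSq (fderiv ℝ (Literature.Analysis.FluidPDE.vorticityDirection (Literature.Analysis.FluidPDE.curl (u q.1))) q.2)))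 ≤ ENNReal.ofReal η)

/-- item stmt-NavierStokesRegularity-1920 · crux · rank 2 · open · by planner
why it might fail: L¹-vorticity level = excluded CZ corner (p,q)=(1,∞) of GKT2007 Thm 1.1(iii) (velocity from L¹ vorticity only weak-L^{3/2}); ∫|u|²|ω| is critical but uncontrolled by E,G; a Type-II nearly-2.5D concentration with G→0, E→∞ is not excluded by '2D+small' theory. ChaeWolf2024 unread: may make it known.
sources: CaffarelliKohnNirenberg1982 Prop 2, Lin1998 Thm 1.1, GustafsonKangTsai2007 Thm 1.1(iii) (arXiv:math/0607114 pp.2-4), Constantin1990 (book:cannone2006-mathematical-foundation-turbulent-viscous-flows p.47), ConstantinFefferman1993, GrujicGuberovic2010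
[crux] A, GEOMETRIC ε-REGULARITY, strong form (card item 2/3 'G alone'): there is an absolute ε>0
such that for every T>0, every classical NS solution (ν=1, f=0) on ℝ³×[0,T) which is Leray–Hopf from
a rapidly decaying datum, and every x: if G(r,(T,x);u) ≤ ε for all r ∈ (0,r₀) then u is bounded on
some backward cylinder Q_r(T,x) ((T,x) is a regular point in the sense of
GKT2007/BarkerPrange2020Alignment). G(r,(T,x);u) = r⁻¹∫∫_{Q_r(T,x)} |ω||∇ξ|² (ω = curl u, ξ = ω/|ω|
= vorticityDirection, |∇ξ|² = frobeniusNormSq of fderiv, backward cylinder parabolicCylinder r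
(T,x); density 0 where ω = 0). Reading: a singular top point carries a QUANTUM of direction
dissipation per unit parabolic length at a sequence of scales ('vortex lines must kink at every
singularity'); endpoint cases hold (G ≡ 0 ⇒ ξ locally constant ⇒ div ω = 0 makes the flow 2.5D; E
small is CKN). Mechanism proposed by the card: CKN/Lin iteration at the |ω|-balance level,
stretching slaved to (∫|u|²|ω|φ)^{1/2}(∫|ω||∇ξ|²φ)^{1/2} by the localised Constantin identity
∫(ξ·Sξ)|ω|φ = −∫u·(ω·∇ξ)φ − ∫(u·ξ)(ω·∇φ) (div ω = 0); a third scaled quantity (C(r) or W(r) = sup_t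
r⁻¹∫_{B_r}|ω| or an |ω|log(2+|ω|) level) is expected to be nee -/
@[route_item "route-NavierStokesRegularity-DirectionDissipationQuantum", crux]
def GeometricEpsilonRegularity : Prop :=
  ∃ ε : ℝ, 0 < ε ∧ ∀ T : ℝ, 0 < T → ∀ (u : ℝ → EuclideanSpace ℝ (Fin 3) → EuclideanSpace ℝ (Fin 3)) (p : ℝ → EuclideanSpace ℝ (Fin 3) → ℝ), Literature.Analysis.FluidPDE.IsClassicalNSSolutionOn (Set.Ico 0 T) 1 0 u p → Literature.Analysis.FluidPDE.IsLerayHopfOn T 1 0 (u 0) u → Literature.Analysis.FluidPDE.HasRapidSpatialDecay (u 0) → ∀ x : EuclideanSpace ℝ (Fin 3), (∃ r₀ : ℝ, 0 < r₀ ∧ ∀ r ∈ Set.Ioo 0 r₀, (ENNReal.ofReal r)⁻¹ * (∫⁻ q in Literature.Analysis.FluidPDE.parabolicCylinder r ((T, x) : ℝ × EuclideanSpace ℝ (Fin 3)), ENNReal.ofReal (‖Literature.Analysis.FluidPDE.curl (u q.1) q.2‖ * Literature.Analysis.FluidPDE.frobeniusNormSq (fderiv ℝ (Literature.Analysis.FluidPDE.vorticityDirection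 (Literature.Analysis.FluidPDE.curl (u q.1))) q.2))) ≤ ENNReal.ofReal ε) → ∃ r : ℝ, 0 < r ∧ ∃ M : ℝ, ∀ t ∈ Set.Ioo (T - r ^ 2) T, ∀ y ∈ Metric.ball x r, ‖u t y‖ ≤ M

/-- item stmt-NavierStokesRegularity-1922 · crux · rank 4 · open · by planner
why it might fail: Given crux A it is NoBlowup-hard; Constantin's budget has energy scaling (EnergySupercriticality bites) and yields only P¹-null concentration; even at regular T it needs local integrability of |ω||∇ξ|² uniformly in t for smooth fields, plausible but not in print.
sources: Constantin1990 (book:cannone2006-mathematical-foundation-turbulent-viscous-flows p.47), CaffarelliKohnNirenberg1982 Thm B (in-tree ckn_partial_regularity_holds), Tao2016AveragedNS (arXiv:1402.0290 p.11), Hou2022PotentiallySingularNS (arXiv:2107.06509), Literature.Barriers.NavierStokesRegularity.EnergySupercriticality, stmt-NavierStokesRegularity-0091 (VorticityGeometry)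
[crux] N, A-PRIORI NON-CONCENTRATION OF DIRECTION DISSIPATION (card item 4; the regularity-hard
side, no mechanism claimed): for T>0 and every classical NS solution (ν=1, f=0) on ℝ³×[0,T) which is
Leray–Hopf from a rapidly decaying datum, at EVERY x: G(r,(T,x);u) → 0 as r → 0 (∀η>0 ∃r₀>0
∀r∈(0,r₀), G ≤ η). G(r,(T,x);u) = r⁻¹∫∫_{Q_r(T,x)} |ω||∇ξ|² (ω = curl u, ξ = ω/|ω| =
vorticityDirection, |∇ξ|² = frobeniusNormSq of fderiv, backward cylinder parabolicCylinder r (T,x);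
density 0 where ω = 0). A priori: ∫₀ᵀ∫|ω||∇ξ|² ≤ ½‖u₀‖²₂ (Constantin1990; book:cannone2006 p.47), so
by Vitali the set of top points where limsup G > 0 is P¹-null — exactly CKN's information for E; N
asserts it is EMPTY. Strictly weaker than route VorticityGeometry's crux
stmt-NavierStokesRegularity-0091 (Lipschitz coherence with constant 1/ρ on {|ω|>Ω} gives G(r) ≤ ρ⁻²
r W(r) → 0). At REGULAR top times it reduces to sup_{t<T}∫_{B_1(x)}|ω||∇ξ|²dy < ∞ for smooth
divergence-free fields (finite-order zeros of codimension ≥ 2 give integrable singularities ρ^{k−2},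
codimension-1 zeros have bounded density |P_ξ⊥∇ω|²/|ω|) — expected, a refuter should test it first;
the content is at singular T. Levers recorded on the card ( -/
@[route_item "route-NavierStokesRegularity-DirectionDissipationQuantum", crux]
def DirectionDissipationNonConcentration : Prop :=
  ∀ T : ℝ, 0 < T → ∀ (u : ℝ → EuclideanSpace ℝ (Fin 3) → EuclideanSpace ℝ (Fin 3)) (p : ℝ → EuclideanSpace ℝ (Fin 3) → ℝ), Literature.Analysis.FluidPDE.IsClassicalNSSolutionOn (Set.Ico 0 T) 1 0 u p → Literature.Analysis.FluidPDE.IsLerayHopfOn T 1 0 (u 0) u → Literature.Analysis.FluidPDE.HasRapidSpatialDecay (u 0) → ∀ x : EuclideanSpace ℝ (Fin 3), ∀ η : ℝ, 0 < η → ∃ r₀ : ℝ, 0 < r₀ ∧ ∀ r ∈ Set.Ioo 0 r₀, (ENNReal.ofReal r)⁻¹ * (∫⁻ q in Literature.Analysis.FluidPDE.parabolicCylinder r ((T, x) : ℝ × EuclideanSpace ℝ (Fin 3)), ENNReal.ofReal (‖Literature.Analysis.FluidPDE.curl (u q.1) q.2‖ * Literature.Analysis.FluidPDE.frobeniusNormSq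 (fderiv ℝ (Literature.Analysis.FluidPDE.vorticityDirection (Literature.Analysis.FluidPDE.curl (u q.1))) q.2))) ≤ ENNReal.ofReal η

/-- item stmt-NavierStokesRegularity-1921 · aside · rank 3 · open · by planner
why it might fail: The limit must inherit |ω||∇ξ|² ≡ 0: C¹_loc convergence of ω near zeros of ω̄ and analyticity/unique continuation to globalise 'ξ̄ locally constant' are needed; persistence of the vertex singularity needs A–B-type Type-I bounds (all sub-balls) from the sup-norm rate (AlbrittonBarker2019 Lemma 2.4).
sources: GigaMiura2011 (paywalled, acq-01588), GigaHsuMaekawa2014 Thm 1.2, p.16 Step 3 (arXiv:1310.6471), BarkerPrange2020Alignment Thm 1, Thm 3 (arXiv:1906.08225 pp.3,18), AlbrittonBarker2019 Lemma 2.4, RusinSverak2011 Lemma 2.1 (in-tree rusin_sverak_stability_of_singularities_holds), KNSS2009 Prop 6.1, Thm 5.1 (in-tree KNSS2009_blowup_generates_ancient_holds, KNSS2009_liouville_planar_holds)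
[crux] B, TYPE-I DIRECTION CRITERION (card item 3; integral upgrade of Giga–Miura / Barker–Prange
continuous alignment): for T>0 and a classical NS solution (ν=1) on ℝ³×[0,T), Leray–Hopf from a
rapidly decaying datum, with the Type-I rate IsTypeIBlowup u T (‖u(t)‖∞ ≤ C(T−t)^{-1/2} eventually),
and a point x with G(r,(T,x);u) → 0 as r→0: u is bounded on some Q_r(T,x). G(r,(T,x);u) =
r⁻¹∫∫_{Q_r(T,x)} |ω||∇ξ|² (ω = curl u, ξ = ω/|ω| = vorticityDirection, |∇ξ|² = frobeniusNormSq of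
fderiv, backward cylinder parabolicCylinder r (T,x); density 0 where ω = 0). Proof plan (layer 2,
not filed): rescale CENTRED AT THE TOP POINT, u_n(s,y) = R_n u(T+R_n²s, x+R_n y), R_n → 0
(BarkerPrange2020Alignment Thm 3, arXiv:1906.08225 p.18): G_{u_n}(ρ,(0,0)) = G_u(R_nρ,(T,x)) → 0 for
EVERY ρ, so the Type-I ancient limit ū (|ū| ≤ C(−s)^{-1/2}, smooth for s<0) has |ω̄||∇ξ̄|² ≡ 0 on
ℝ³×(−∞,0) (needs C¹_loc convergence of vorticity; Fatou); ξ̄ locally constant on {ω̄≠0} ⇒ (spatial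
analyticity / unique continuation) ω̄ ∥ e globally ⇒ UnidirectionalAncientLiouville (support) ⇒
ū(s,·) constant ⇒ by mildness and Type-I decay ū ≡ 0; but if (T,x) were singular the vertex
singularity persists in the limit (RusinSve -/
@[route_item "route-NavierStokesRegularity-DirectionDissipationQuantum"]
def TypeIDirectionCriterion : Prop :=
  ∀ T : ℝ, 0 < T → ∀ (u : ℝ → EuclideanSpace ℝ (Fin 3) → EuclideanSpace ℝ (Fin 3)) (p : ℝ → EuclideanSpace ℝ (Fin 3) → ℝ), Literature.Analysis.FluidPDE.IsClassicalNSSolutionOn (Set.Ico 0 T) 1 0 u p → Literature.Analysis.FluidPDE.IsLerayHopfOn T 1 0 (u 0) u → Literature.Analysis.FluidPDE.HasRapidSpatialDecay (u 0) → Literature.Analysis.FluidPDE.IsTypeIBlowup u T → ∀ x : EuclideanSpace ℝ (Fin 3), (∀ η : ℝ, 0 < η → ∃ r₀ : ℝ, 0 < r₀ ∧ ∀ r ∈ Set.Ioo 0 r₀, (ENNReal.ofReal r)⁻¹ * (∫⁻ q in Literature.Analysis.FluidPDE.parabolicCylinder r ((T, x) : ℝ × EuclideanSpace ℝ (Fin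 3)), ENNReal.ofReal (‖Literature.Analysis.FluidPDE.curl (u q.1) q.2‖ * Literature.Analysis.FluidPDE.frobeniusNormSq (fderiv ℝ (Literature.Analysis.FluidPDE.vorticityDirection (Literature.Analysis.FluidPDE.curl (u q.1))) q.2))) ≤ ENNReal.ofReal η) → ∃ r : ℝ, 0 < r ∧ ∃ M : ℝ, ∀ t ∈ Set.Ioo (T - r ^ 2) T, ∀ y ∈ Metric.ball x r, ‖u t y‖ ≤ M

/-- item stmt-NavierStokesRegularity-0055 · support · rank 9 · closed · proved by Summit.NavierStokesRegularity.NavierStokesRegularity.Theorems.typeICertificateLadder_noBlowupToClay_proof @ 8d57e70af7e2 (prover) · by planner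
sources: Leray1934, Fefferman2000
Given NoBlowup, build the Clay (A) solution: local finite-energy classical solution for smooth
divergence-free rapidly decaying data (Leray 1934 §III / Fujita–Kato 1964 + LPS smoothing), continue
past every T using NoBlowup, glue by weak–strong uniqueness (Prodi–Serrin), bounded energy from the
energy inequality, and convert with
Literature.Analysis.FluidPDE.isNavierStokesSolution_and_smooth_iff. Blow-up at spatial infinity is
excluded by CKN ε-regularity applied far out. May take named Literature facts (leray_existence_R3,
ladyzhenskaya_prodi_serrin, weak_strong_uniqueness, fujita_kato_local) as hypotheses if the grounder
so rules. -/
@[route_item "route-NavierStokesRegularity-DirectionDissipationQuantum", crux]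
def NoBlowupToClay : Prop :=
  (∀ (ν T : ℝ), 0 < ν → 0 < T → ∀ (u : ℝ → EuclideanSpace ℝ (Fin 3) → EuclideanSpace ℝ (Fin 3)) (p : ℝ → EuclideanSpace ℝ (Fin 3) → ℝ), Literature.Analysis.FluidPDE.IsClassicalNSSolutionOn (Set.Ico 0 T) ν 0 u p → Literature.Analysis.FluidPDE.IsLerayHopfOn T ν 0 (u 0) u → Literature.Analysis.FluidPDE.HasRapidSpatialDecay (u 0) → Literature.Analysis.FluidPDE.HasSmoothExtensionPast ν 0 u T) → NavierStokesRegularity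

/-- `NoBlowupToClay` holds: proved by `Summit.NavierStokesRegularity.NavierStokesRegularity.Theorems.typeICertificateLadder_noBlowupToClay_proof` @ 8d57e70af7e2. -/
theorem NoBlowupToClay_holds : NoBlowupToClay := _root_.Summit.NavierStokesRegularity.NavierStokesRegularity.Theorems.typeICertificateLadder_noBlowupToClay_proof

/-- item stmt-NavierStokesRegularity-1923 · support · rank 9 · closed · proved by Summit.NavierStokesRegularity.NavierStokesRegularity.Theorems.unidirectionalAncientLiouville_proof @ f578909b3b51 (prover) · by planner
why it might fail: The duality-form IsBoundedAncientMildSolution may be too weak for the planar descent/Liouville bookkeeping (SelfSimilarLiouville.lean warning: b(t) not pinned); harmless for the conclusion (b(t) allowed), but smoothness/gradient bounds are supplied as hypotheses for this reason.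
sources: KNSS2009 Thm 5.1, proof of Thm 6.2 p.13 (in-tree KNSS2009_liouville_planar_holds), GigaMiura2011, GigaHsuMaekawa2014 p.16 Step 3 (arXiv:1310.6471)
[support] LIOUVILLE FOR UNIDIRECTIONAL ANCIENT SOLUTIONS (engine of crux B; Literature-grade lemma):
a bounded ancient mild solution v of NS (ν=1) on ℝ³×(−∞,0) (in-tree IsBoundedAncientMildSolution 1
v), smooth, with bounded gradient, whose vorticity is everywhere parallel to one fixed unit vector e
(curl(v t) x = c·e), is constant on every time slice. Proof (~2 pp + bookkeeping): rotate e = e₃;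
div ω = 0 ⇒ ∂₃ω₃ = 0 ⇒ ∂₃v is curl- and divergence-free, hence harmonic and bounded ⇒ ∂₃v = a(t)
(Liouville), and boundedness of v forces a = 0; so v = w(x₁,x₂,t): (w₁,w₂) is a bounded ancient
(weak/mild) planar solution ⇒ = b_h(t) by KNSS2009 Thm 5.1 (in-tree PROVED
KNSS2009_liouville_planar_holds; planar descent as in PlanarDescentWeak / KNSS Thm 6.2 p.13); then
w₃ solves the heat equation with spatially constant drift b_h(t), bounded and ancient ⇒ constant in
x. GigaMiura2011/GigaHsuMaekawa2014 p.16 use the same reduction with a pointwise-constant ξ̄. The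
prover of B must first globalise 'ξ̄ locally constant on {ω̄≠0}' to 'ω̄ ∥ e' (spatial analyticity of
bounded mild solutions). -/
@[route_item "route-NavierStokesRegularity-DirectionDissipationQuantum"]
def UnidirectionalAncientLiouville : Prop :=
  ∀ (v : ℝ → EuclideanSpace ℝ (Fin 3) → EuclideanSpace ℝ (Fin 3)) (e : EuclideanSpace ℝ (Fin 3)), ‖e‖ = 1 → Literature.Analysis.FluidPDE.IsBoundedAncientMildSolution 1 v → ContDiffOn ℝ (⊤ : ℕ∞) (Function.uncurry v) (Set.Iio 0 ×ˢ Set.univ) → (∃ C : ℝ, ∀ t < 0, ∀ x, ‖fderiv ℝ (v t) x‖ ≤ C) → (∀ t < 0, ∀ x, ∃ c : ℝ, Literature.Analysis.FluidPDE.curl (v t) x = c • e) → ∀ t < 0, ∀ x y, v t x = v t y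

-- `UnidirectionalAncientLiouville` holds: proved by `Summit.NavierStokesRegularity.NavierStokesRegularity.Theorems.unidirectionalAncientLiouville_proof` @ f578909b3b51 (its module imports this route file, so no `_holds` link can be stated here).

/-- item stmt-NavierStokesRegularity-1924 · support · rank 9 · closed · proved by Summit.NavierStokesRegularity.NavierStokesRegularity.Theorems.directionDissipationQuantum_boundedNearTopExtends_proof (prover) · by planner
sources: Leray1934 §20 (in-tree leray_blowup_rate_top_holds), LemarieRieusset2016 Thm 15.1(C), Thm 14.5 (in-tree leray_solution_farField_bound_slab_holds), Tao2011 Cor 11.1 (stmt-NavierStokesRegularity-0723, cite wi-04767), CaffarelliKohnNirenberg1982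
[support] GLUE: for ν>0, T>0 and a classical NS solution on ℝ³×[0,T), Leray–Hopf from a rapidly
decaying datum, local boundedness below the top at EVERY point (∀x ∃r>0 ∃M: |u| ≤ M on Q_r(T,x))
implies HasSmoothExtensionPast ν 0 u T. Proof (standard, all engines PROVED in tree): far-field
bound on a slab (leray_solution_farField_bound_slab_holds: |u| bounded on (t₁,T)×{|x|>R}) +
compactness of the closed ball B̄_R (finitely many cylinders, δ = min r²) ⇒ u ∈ L^∞((T−δ,T)×ℝ³);
boundedness on closed sub-slabs [0,T′] (stmt-NavierStokesRegularity-0723-type composite / Tao2011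
closed-slab bounds) ⇒ u ∈ L^∞([0,T)×ℝ³); if u had no extension it would be maximal and Leray's rate
c√ν(T−t)^{-1/2} ≤ ‖u(t)‖∞ (leray_blowup_rate_top_holds) contradicts boundedness; hence ¬maximal,
i.e. HasSmoothExtensionPast (IsMaximalSmoothSolution := classical ∧ ¬extends). Class bridging
(classical LH from Schwartz datum ↦ local Leray solution on the slab with L³ datum) is the only real
work. -/
@[route_item "route-NavierStokesRegularity-DirectionDissipationQuantum", crux]
def BoundedNearTopExtends : Prop :=
  ∀ (ν T : ℝ), 0 < ν → 0 < T → ∀ (u : ℝ → EuclideanSpace ℝ (Fin 3) → EuclideanSpace ℝ (Fin 3)) (p : ℝ → EuclideanSpace ℝ (Fin 3) → ℝ), Literature.Analysis.FluidPDE.IsClassicalNSSolutionOn (Set.Ico 0 T) ν 0 u p → Literature.Analysis.FluidPDE.IsLerayHopfOn T ν 0 (u 0) u → Literature.Analysis.FluidPDE.HasRapidSpatialDecay (u 0) → (∀ x : EuclideanSpace ℝ (Fin 3), ∃ r : ℝ, 0 < r ∧ ∃ M : ℝ, ∀ t ∈ Set.Ioo (T - r ^ 2) T, ∀ y ∈ Metric.ball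 x r, ‖u t y‖ ≤ M) → Literature.Analysis.FluidPDE.HasSmoothExtensionPast ν 0 u T

-- `BoundedNearTopExtends` holds: proved by `Summit.NavierStokesRegularity.NavierStokesRegularity.Theorems.directionDissipationQuantum_boundedNearTopExtends_proof` (its module imports this route file, so no `_holds` link can be stated here).

/-- item stmt-NavierStokesRegularity-1925 · support · rank 9 · closed · proved by Summit.NavierStokesRegularity.NavierStokesRegularity.Theorems.directionDissipationQuantum_unitViscosityReduction_proof (prover) · by planner
sources: Fefferman2000 (all ν>0 equivalent by scaling; Statement.lean docstring), CaffarelliKohnNirenberg1982 (ν = 1 normalisation)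
[support] GLUE: NoBlowup for ν = 1 implies NoBlowup for every ν > 0. For a classical LH solution u
with viscosity ν on [0,T) put v(s,x) := ν⁻¹ u(s/ν, x), q(s,x) := ν⁻² p(s/ν, x): v is a classical
solution with viscosity 1 on [0,νT), Leray–Hopf from the rapidly decaying datum ν⁻¹u(0); an
extension of v past νT rescales back to an extension of u past T. In-tree tools:
IsClassicalNSSolutionOn.stRescale / nsRescale_holds (ClassicalSolutionRescale.lean),
IsWeakNSSolutionOn.nsRescale and energyIneq_nsRescale (LerayHopfNSRescale.lean),
HasRapidSpatialDecay is homogeneous. Routine (~150 lines). -/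
@[route_item "route-NavierStokesRegularity-DirectionDissipationQuantum", crux]
def UnitViscosityReduction : Prop :=
  (∀ T : ℝ, 0 < T → ∀ (u : ℝ → EuclideanSpace ℝ (Fin 3) → EuclideanSpace ℝ (Fin 3)) (p : ℝ → EuclideanSpace ℝ (Fin 3) → ℝ), Literature.Analysis.FluidPDE.IsClassicalNSSolutionOn (Set.Ico 0 T) 1 0 u p → Literature.Analysis.FluidPDE.IsLerayHopfOn T 1 0 (u 0) u → Literature.Analysis.FluidPDE.HasRapidSpatialDecay (u 0) → Literature.Analysis.FluidPDE.HasSmoothExtensionPast 1 0 u T) → ∀ (ν T : ℝ), 0 < ν → 0 < T → ∀ (u : ℝ → EuclideanSpace ℝ (Fin 3) → EuclideanSpace ℝ (Fin 3)) (p : ℝ → EuclideanSpace ℝ (Fin 3) → ℝ), Literature.Analysis.FluidPDE.IsClassicalNSSolutionOn (Set.Ico 0 T) ν 0 u p → Literature.Analysis.FluidPDE.IsLerayHopfOn T ν 0 (u 0) u → Literature.Analysis.FluidPDE.HasRapidSpatialDecay (u 0) → Literature.Analysis.FluidPDE.HasSmoothExtensionPast ν 0 u T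

-- `UnitViscosityReduction` holds: proved by `Summit.NavierStokesRegularity.NavierStokesRegularity.Theorems.directionDissipationQuantum_unitViscosityReduction_proof` (its module imports this route file, so no `_holds` link can be stated here).

/-- item stmt-NavierStokesRegularity-1919 · assembly · rank 1 · closed · proved by Summit.NavierStokesRegularity.NavierStokesRegularity.Theorems.directionDissipationQuantum_assembly_proof (prover) · by planner
sources: Fefferman2000, CaffarelliKohnNirenberg1982, Constantin1990
[assembly] GeometricEpsilonRegularity → DirectionDissipationNonConcentration → BoundedNearTopExtends
→ UnitViscosityReduction → NoBlowupToClay (stmt-NavierStokesRegularity-0055) →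
NavierStokesRegularity. PURE LOGIC, proved sorry-free in the planner's Sketch.lean (theorem
assembly_proof, 9 tactic lines): fix T,u,p in the NoBlowup premises at ν=1; for each x, N with η :=
ε gives the smallness hypothesis of A, A gives local boundedness near (T,x); the glue gives
HasSmoothExtensionPast 1 0 u T; UnitViscosityReduction lifts to all ν; NoBlowupToClay gives Clay
(A). -/
@[route_item "route-NavierStokesRegularity-DirectionDissipationQuantum"]
def Assembly : Prop :=
  (∃ ε : ℝ, 0 < ε ∧ ∀ T : ℝ, 0 < T → ∀ (u : ℝ → EuclideanSpace ℝ (Fin 3) → EuclideanSpace ℝ (Fin 3)) (p : ℝ → EuclideanSpace ℝ (Fin 3) → ℝ), Literature.Analysis.FluidPDE.IsClassicalNSSolutionOn (Set.Ico 0 T) 1 0 u p → Literature.Analysis.FluidPDE.IsLerayHopfOn T 1 0 (u 0) u → Literature.Analysis.FluidPDE.HasRapidSpatialDecay (u 0) → ∀ x : EuclideanSpace ℝ (Fin 3), (∃ r₀ : ℝ, 0 < r₀ ∧ ∀ r ∈ Set.Ioo 0 r₀, (ENNReal.ofReal r)⁻¹ * (∫⁻ q in Literature.Analysis.FluidPDE.parabolicCylinder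 r ((T, x) : ℝ × EuclideanSpace ℝ (Fin 3)), ENNReal.ofReal (‖Literature.Analysis.FluidPDE.curl (u q.1) q.2‖ * Literature.Analysis.FluidPDE.frobeniusNormSq (fderiv ℝ (Literature.Analysis.FluidPDE.vorticityDirection (Literature.Analysis.FluidPDE.curl (u q.1))) q.2))) ≤ ENNReal.ofReal ε) → ∃ r : ℝ, 0 < r ∧ ∃ M : ℝ, ∀ t ∈ Set.Ioo (T - r ^ 2) T, ∀ y ∈ Metric.ball x r, ‖u t y‖ ≤ M) → (∀ T : ℝ, 0 < T → ∀ (u : ℝ → EuclideanSpace ℝ (Fin 3) → EuclideanSpace ℝ (Fin 3)) (p : ℝ → EuclideanSpace ℝ (Fin 3) → ℝ), Literature.Analysis.FluidPDE.IsClassicalNSSolutionOn (Set.Ico 0 T) 1 0 u p → Literature.Analysis.FluidPDE.IsLerayHopfOn T 1 0 (u 0) u → Literature.Analysis.FluidPDE.HasRapidSpatialDecay (u 0) → ∀ x : EuclideanSpace ℝ (Fin 3), ∀ η : ℝ, 0 < η → ∃ r₀ : ℝ, 0 < r₀ ∧ ∀ r ∈ Set.Ioo 0 r₀, (ENNReal.ofReal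 r)⁻¹ * (∫⁻ q in Literature.Analysis.FluidPDE.parabolicCylinder r ((T, x) : ℝ × EuclideanSpace ℝ (Fin 3)), ENNReal.ofReal (‖Literature.Analysis.FluidPDE.curl (u q.1) q.2‖ * Literature.Analysis.FluidPDE.frobeniusNormSq (fderiv ℝ (Literature.Analysis.FluidPDE.vorticityDirection (Literature.Analysis.FluidPDE.curl (u q.1))) q.2))) ≤ ENNReal.ofReal η) → (∀ (ν T : ℝ), 0 < ν → 0 < T → ∀ (u : ℝ → EuclideanSpace ℝ (Fin 3) → EuclideanSpace ℝ (Fin 3)) (p : ℝ → EuclideanSpace ℝ (Fin 3) → ℝ), Literature.Analysis.FluidPDE.IsClassicalNSSolutionOn (Set.Ico 0 T) ν 0 u p → Literature.Analysis.FluidPDE.IsLerayHopfOn T ν 0 (u 0) u → Literature.Analysis.FluidPDE.HasRapidSpatialDecay (u 0) → (∀ x : EuclideanSpace ℝ (Fin 3), ∃ r : ℝ, 0 < r ∧ ∃ M : ℝ, ∀ t ∈ Set.Ioo (T - r ^ 2) T, ∀ y ∈ Metric.ball x r, ‖u t y‖ ≤ M) → Literature.Analysis.FluidPDE.HasSmoothExtensionPast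 ν 0 u T) → ((∀ T : ℝ, 0 < T → ∀ (u : ℝ → EuclideanSpace ℝ (Fin 3) → EuclideanSpace ℝ (Fin 3)) (p : ℝ → EuclideanSpace ℝ (Fin 3) → ℝ), Literature.Analysis.FluidPDE.IsClassicalNSSolutionOn (Set.Ico 0 T) 1 0 u p → Literature.Analysis.FluidPDE.IsLerayHopfOn T 1 0 (u 0) u → Literature.Analysis.FluidPDE.HasRapidSpatialDecay (u 0) → Literature.Analysis.FluidPDE.HasSmoothExtensionPast 1 0 u T) → ∀ (ν T : ℝ), 0 < ν → 0 < T → ∀ (u : ℝ → EuclideanSpace ℝ (Fin 3) → EuclideanSpace ℝ (Fin 3)) (p : ℝ → EuclideanSpace ℝ (Fin 3) → ℝ), Literature.Analysis.FluidPDE.IsClassicalNSSolutionOn (Set.Ico 0 T) ν 0 u p → Literature.Analysis.FluidPDE.IsLerayHopfOn T ν 0 (u 0) u → Literature.Analysis.FluidPDE.HasRapidSpatialDecay (u 0) → Literature.Analysis.FluidPDE.HasSmoothExtensionPast ν 0 u T) → ((∀ (ν T : ℝ), 0 < ν → 0 < T → ∀ (u : ℝ → EuclideanSpace ℝ (Fin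 3) → EuclideanSpace ℝ (Fin 3)) (p : ℝ → EuclideanSpace ℝ (Fin 3) → ℝ), Literature.Analysis.FluidPDE.IsClassicalNSSolutionOn (Set.Ico 0 T) ν 0 u p → Literature.Analysis.FluidPDE.IsLerayHopfOn T ν 0 (u 0) u → Literature.Analysis.FluidPDE.HasRapidSpatialDecay (u 0) → Literature.Analysis.FluidPDE.HasSmoothExtensionPast ν 0 u T) → NavierStokesRegularity) → NavierStokesRegularity

-- `Assembly` holds: proved by `Summit.NavierStokesRegularity.NavierStokesRegularity.Theorems.directionDissipationQuantum_assembly_proof` (its module imports this route file, so no `_holds` link can be stated here).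

/-! D-0027 §2.1 — DECIDING THEOREM (planner-authored via `route open/edit --closes-file`; by planner-rbadge-NavierStokesRegularity-Directio-66c37ea2-g2-0 2026-08-15T16:09:39Z):
its hypotheses are this route's items and its conclusion the sub-problem Statement (glue_lint), and it elaborates with this file. -/

@[closes "route-NavierStokesRegularity-DirectionDissipationQuantum"] theorem closes (hA : GeometricEpsilonRegularity) (hN : DirectionDissipationNonConcentration)
    (hExt : BoundedNearTopExtends) (hUnit : UnitViscosityReduction) (hClay : NoBlowupToClay) :
    NavierStokesRegularity := by
  refine hClay (hUnit ?_)
  intro T hT u p hcl hLH hdec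
  obtain ⟨ε, hε, hAε⟩ := hA
  refine hExt 1 T one_pos hT u p hcl hLH hdec ?_
  intro x
  exact hAε T hT u p hcl hLH hdec x (hN T hT u p hcl hLH hdec x ε hε)

end Summit.NavierStokesRegularity.NavierStokesRegularity.Theses.DirectionDissipationQuantum
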